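import Mathlib.FieldTheory.IsAlgClosed.Basic
import Mathlib.LinearAlgebra.Dual.Defs
import Mathlib.LinearAlgebra.Matrix.Determinant.Basic
import Mathlib.Algebra.Category.ModuleCat.Biproducts
import Mathlib.RingTheory.Ideal.Cotangent
import Mathlib.RingTheory.AdicCompletion.Basic
import Literature.AlgebraicGeometry.Resolution.ResolutionOfSingularities
import Literature.AlgebraicGeometry.Resolution.MaximalPoints
import Literature.AlgebraicGeometry.Motives.CartierDivisorIntersectionCycle
import Literature.AlgebraicGeometry.Morphisms.CechH1
import HarnessLib

/-!
# Reflexive modules over rational double points: first Chern classes of full sheaves are dual to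
# the exceptional curves (Artin–Verdier 1985, Theorem (1.11))

Topic: `Literature/AlgebraicGeometry/Resolution`. NAMED FACT (D-0014) vendored for the cite item
`wi-35486` of route `ResolutionOfSingularities/SyzygyFlattening` (support `SurfaceTermination`:
"at rational points each step extracts the exceptional curves dual to the summands of `Ω²(k)`").

## The source (read from the printed paper, Math. Ann. 270 (1985) 79–82)

Artin–Verdier, Introduction (p. 79): "Let `𝒪` denote a complete local algebra of dimension 2 with
maximal ideal `𝔪` over an algebraically closed field `k`, such that `𝒪/𝔪 ≃ k`. Assume that the
spectrum of `𝒪` is a rational double point [1, 6]. … Since the group `G` is not always available in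
characteristic `p`, it seems of some interest to derive the correspondence (i) ↔ (ii) directly,
without assumption on the residue characteristic. This is done by Theorem (1.11)." (p. 79):
"Let `X = Spec 𝒪`, and let `X̃ → X` denote the minimal resolution …, `C = ∪ C_i` the closed fibre
of `π`. For any `𝒪`-module `M`, we denote by `M̃` the `𝒪̃`-module `π^*M/(𝔪-torsion)`. Recall that an
`𝒪`-module is reflexive if it is of finite type and isomorphic to its bidual." Lemma (1.1): "(i)
`π_*M̃ = M` and `R¹π_*M̃ = 0`, (ii) `M̃` is a locally free `𝒪̃`-module, generated by global sections."
Remark (1.6) (ii): "The class `[D̃]` of `D̃` in `Pic X̃` is the Chern class `c₁(M̃)` of `M̃`."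
**Theorem (1.11).** "Let `𝒪` be a rational double point. (i) Let `M` be a non-trivial
indecomposable reflexive `𝒪`-module. The Chern class `c₁(M̃) ∈ Pic X̃` is represented by a
transversal divisor `D̃_i` to a component `C_i` of the exceptional curve of `π`, and the
multiplicity of `C_i` in the fundamental cycle `Z` is `(D̃_i · Z) = rank M`. The Chern class
establishes a 1–1 correspondence between isomorphism classes of non-trivial, indecomposable
reflexive `𝒪`-modules `M` and irreducible components of `C`, or equivalently, vertices of the
Dynkin diagram associated to `𝒪`. (ii) The Chern character `(rk M̃, c₁(M̃))` distinguishes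
isomorphism classes of reflexive `𝒪`-modules `M`."

## What is vendored, and in which vocabulary (Mathlib has no `Pic`, no Chern classes of coherent
## sheaves, no minimal resolutions; the tree has Cartier divisors and their degrees on curves)

* `IsMinimalResolution π` — a resolution (`IsResolution`: proper, birational, regular source)
  through which every resolution factors (Bădescu, Prop. 4.5: the minimal desingularization has,
  and is characterised up to isomorphism by, this universal property).
* `excPoints π` — the generic points of the irreducible components `C_i` of the closed fibre
  `C = π⁻¹(𝔪)` (`maxPoints` of `Resolution/MaximalPoints`); the component itself is the integral
  closed subscheme `ClosedSubvariety.ofPoint X̃ η` (`Motives/ClosedSubvarietyOfPoint`).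
* `excDegree k π D η = (D · C_η)` — the intersection number of a Cartier divisor `D` on `X̃`
  (`Motives/CartierDivisor`) with the exceptional curve `C_η`: the degree over `k`,
  `Σ_y ord_y(D|_{C_η}) [κ(y) : k]`, of the restricted divisor (`CartierDivisor.pullbackRep`,
  `CartierDivisor.ordAt`, Mathlib `Scheme.Hom.residueDegree`; Fulton, Def. 1.4 and Def. 2.3, as in
  `Motives/CartierDivisorCurveDegree` and `Motives/CartierDivisorIntersectionCycle`).
* `IsChernDivisorOfFullSheaf π M D` — "`D` represents `c₁(M̃) = [det M̃] ∈ Pic X̃`", made concrete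
  inside the function field `K = K(X̃) = Frac 𝒪`: for a torsion-free `M` of rank `r` embedded
  `𝒪`-linearly in `K^r`, the full sheaf `M̃ = π^*M/torsion` is the subsheaf `U ↦ 𝒪_{X̃}(U)·M` of
  `K^r`, its determinant `det M̃` is the fractional ideal sheaf spanned by the `r × r` minors of
  elements of `M`, and `D = (U_i, f_i)` represents `c₁(M̃)` iff `𝒪_{X̃}(D)_x = f_i⁻¹ 𝒪_{X̃,x}` equals
  that span at every `x ∈ U_i` (for all — equivalently one — such embedding; a change of embedding
  multiplies all minors by one scalar of `K^×`, i.e. changes `D` inside its linear equivalence class).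
* `maximalIdealCycleMult π η` — the multiplicity of `C_η` in the divisor of `𝔪𝒪_{X̃}`, i.e.
  `min_{g ∈ 𝔪 ∖ 0} ord_{C_η}(g)`; for a RATIONAL singularity `𝔪𝒪_{X̃} = 𝒪_{X̃}(-Z)` with `Z` the
  fundamental cycle (Artin 1966, Thm. 4 = Bădescu, Thm. 3.28), so this is "the multiplicity of
  `C_i` in the fundamental cycle `Z`" of the theorem.
* `IsRationalDoublePointResolution k π` — the standing hypotheses: `𝒪` a complete Noetherian local
  normal domain of Krull dimension `2`, a `k`-algebra with residue field `k`; `π : X̃ → Spec 𝒪` a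
  minimal resolution; RATIONAL: `H¹(X̃, 𝒪_{X̃}) = 0` (Bădescu, Def. 3.17: `R¹π_*𝒪_{X̃} = 0`; the base
  is affine and `X̃` is separated, so this is the vanishing of the Čech `Ȟ¹(𝒰, 𝒪_{X̃})` of
  `Morphisms/CechH1` for every finite affine open cover `𝒰`); DOUBLE POINT: embedding dimension
  `dim_k 𝔪/𝔪² = 3` (for a rational surface singularity the multiplicity is `-Z²` and the embedding
  dimension `-Z² + 1`, Artin 1966, Cor. 6 = Bădescu, Cor. 3.29, so "double point" ⟺ `edim = 3`).
* `ArtinVerdier1985_chernClassBijection` — NAMED FACT, Theorem (1.11) (i) in the numerical form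
  `c₁(M̃_i) · C_j = δ_ij`, `rank M_i = mult_{C_i} Z` (the form in which it is quoted and used:
  Wunram 1988, Thm. 1.2; Liedtke 2024, Thm. 5.6), as three clauses: (a) every non-trivial
  indecomposable reflexive `M` has a Chern divisor, and there is exactly one exceptional curve
  `C_i` with `c₁(M̃) · C_i = 1`, the others having `c₁(M̃) · C_j = 0`, and `rank M = z_i`;
  (b) two such modules with the same curve are isomorphic; (c) every curve occurs.

## What is NOT here

The proof (Lemmas (1.2)–(1.10): generic sections, the dualizing module, `Ext¹(N, ω)`); part (ii)
of Theorem (1.11); the transversal representative `D̃_i` itself (only its intersection numbers are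
stated); Wunram's generalisation to rational singularities (special full sheaves); the
characteristic-zero McKay correspondence with `G ⊂ SL₂`. Reflexive = Mathlib `Module.IsReflexive`
(bijectivity of `M → M^{**}`) with `Module.Finite`; indecomposable = Mathlib
`CategoryTheory.Indecomposable` in `ModuleCat 𝒪`; `rank M = Module.finrank 𝒪 M` (the generic rank,
Mathlib `IsLocalizedModule.lift_rank_eq`).

## References

* M. Artin, J.-L. Verdier, *Reflexive modules over rational double points*, Math. Ann. 270 (1985)
  79–82, Lemma (1.1), Remark (1.6), Theorem (1.11) (read from the GDZ digitisation,
  PURL `resolver.sub.uni-goettingen.de/purl?PID=PPN235181684_0270|LOG_0014`). [ArtinVerdier1985]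
* L. Bădescu, *Algebraic Surfaces*, Universitext, Springer 2001, Def. 3.17, Def. 3.20, Thm. 3.28,
  Cor. 3.29, Thm. 3.31, Def. 4.4, Prop. 4.5 (held copy). [Badescu2001]
* M. Artin, *On isolated rational singularities of surfaces*, Amer. J. Math. 88 (1966) 129–136,
  Thm. 4 and Cor. 6. [Artin1966]
* J. Wunram, Math. Ann. 279 (1988) 583–598, Thm. 1.2 [Wunram1988]; C. Liedtke, Forum Math. Sigma 12
  (2024) e116, Thm. 5.6 (arXiv:2207.06286, read) [Liedtke2024].
* W. Fulton, *Intersection Theory*, 2nd ed. 1998, Def. 1.4, Def. 2.3. [Fulton1998]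
-/

noncomputable section

open CategoryTheory AlgebraicGeometry TopologicalSpace IsLocalRing
open Literature.AlgebraicGeometry.Motives Literature.AlgebraicGeometry.Morphisms

universe u

namespace Literature.AlgebraicGeometry.Resolution

/-! ## Minimal resolutions -/

/-- `π : X' ⟶ X` is a **minimal resolution** of `X`: a resolution of singularities (`IsResolution`:
proper, birational, `X'` regular) through which every resolution `π' : X'' ⟶ X` factors,
`π' = g ≫ π`. For a normal surface singularity this is the minimal desingularization (no
exceptional curves of the first kind in the closed fibre), which exists and has exactly this
universal property, the factorisation being unique (Bădescu 2001, Def. 4.4 and Prop. 4.5; for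
`X = Spec 𝒪`, `𝒪` normal of dimension `2`, a proper birational `π` from a regular scheme is an
isomorphism off the closed point, so `IsResolution` is a desingularization in the sense of
loc. cit., Def. 3.16). [cite: Badescu2001, Def. 4.4 and Prop. 4.5] -/
def IsMinimalResolution {X' X : Scheme.{u}} (π : X' ⟶ X) : Prop :=
  IsResolution π ∧ ∀ (X'' : Scheme.{u}) (π' : X'' ⟶ X), IsResolution π' → ∃ g : X'' ⟶ X', g ≫ π = π'

/-- A minimal resolution is a resolution. [folklore] -/
theorem IsMinimalResolution.isResolution {X' X : Scheme.{u}} {π : X' ⟶ X}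
    (h : IsMinimalResolution π) : IsResolution π :=
  h.1

/-- Every resolution factors through a minimal one. [folklore] -/
theorem IsMinimalResolution.exists_fac {X' X : Scheme.{u}} {π : X' ⟶ X}
    (h : IsMinimalResolution π) {X'' : Scheme.{u}} (π' : X'' ⟶ X) (h' : IsResolution π') :
    ∃ g : X'' ⟶ X', g ≫ π = π' :=
  h.2 X'' π' h'

/-- A regular scheme is its own minimal resolution (through the identity). [folklore] -/
theorem isMinimalResolution_id {X : Scheme.{u}} (h : Scheme.IsRegular X) :
    IsMinimalResolution (𝟙 X) := by
  refine ⟨⟨inferInstance, ⟨⊤, by simp, by simp, inferInstance⟩, h⟩, fun X'' π' _ => ⟨π', ?_⟩⟩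
  simp

/-! ## The closed fibre of `π : X̃ → Spec 𝒪` and intersection numbers with its components -/

section Germ

variable {O : Type u} [CommRing O] {Xt : Scheme.{u}}

/-- The structure morphism `X̃ → Spec 𝒪 → Spec k` of a scheme over a `k`-algebra `𝒪`. [folklore] -/
def toSpecField (k : Type u) [Field k] [Algebra k O] (π : Xt ⟶ Spec (.of O)) : Xt ⟶ Spec (.of k) :=
  π ≫ Spec.map (CommRingCat.ofHom (algebraMap k O))

/-- The **exceptional curves** of `π : X̃ → Spec 𝒪` (`𝒪` local), through their generic points:
the maximal points (`maxPoints`) of the closed fibre `C = π⁻¹(𝔪)`, i.e. the generic points of the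
irreducible components `C_i` of `C` ("`C = ∪ C_i` the closed fibre of `π`", Artin–Verdier p. 79).
[cite: ArtinVerdier1985, p. 79] -/
def excPoints [IsLocalRing O] (π : Xt ⟶ Spec (.of O)) : Set Xt :=
  maxPoints (π.base ⁻¹' {closedPoint O})

/-- Unfolding of `excPoints`. [folklore] -/
theorem mem_excPoints_iff [IsLocalRing O] (π : Xt ⟶ Spec (.of O)) (η : Xt) :
    η ∈ excPoints π ↔ π.base η = closedPoint O ∧
      ∀ η', π.base η' = closedPoint O → η' ⤳ η → η' = η :=
  Iff.rfl

/-- An exceptional point lies in the closed fibre. [folklore] -/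
theorem base_eq_closedPoint_of_mem_excPoints [IsLocalRing O] {π : Xt ⟶ Spec (.of O)} {η : Xt}
    (h : η ∈ excPoints π) : π.base η = closedPoint O :=
  ((mem_excPoints_iff π η).1 h).1

/-- The ring map `𝒪 → Γ(X̃, 𝒪_{X̃}) → 𝒪_{X̃,ξ} = K(X̃)` to the function field of the integral
`𝒪`-scheme `X̃` (`algebraMapΓ`, then the germ at the generic point `ξ`; for `π` birational and
`𝒪` a domain this is the identification `Frac 𝒪 = K(X̃)` restricted to `𝒪`). [folklore] -/
def baseToFunctionField [IsIntegral Xt] (π : Xt ⟶ Spec (.of O)) : O →+* Xt.functionField :=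
  (Xt.presheaf.germ ⊤ (genericPoint Xt) trivial).hom.comp (algebraMapΓ π)

/-- **The intersection number `(D · C_η)` of a Cartier divisor `D` on `X̃` with the exceptional curve
`C_η = closure {η}`** (with its reduced, integral structure `ClosedSubvariety.ofPoint X̃ η`): the
degree over `k` of the restriction of `D` to `C_η`, `Σ_y ord_y(D|_{C_η}) · [κ(y) : k]`
(`CartierDivisor.pullbackRep` — the honest pull-back `(ι⁻¹U_i, ι^♯ f_i)` when `C_η ⊄ |D|`, a
representative of the pulled-back class otherwise; `CartierDivisor.ordAt`; Mathlib
`Scheme.Hom.residueDegree` along `C_η → X̃ → Spec 𝒪 → Spec k`, which is `1` at the closed points of the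
closed fibre when `𝒪/𝔪 = k` is algebraically closed). This is Fulton's `deg (D · [C_η])`
(Def. 2.3 with Def. 1.4), the number written `D · C_η` in Artin–Verdier.
[cite: Fulton1998, Def. 2.3 and Def. 1.4] -/
def excDegree (k : Type u) [Field k] [Algebra k O] [IsIntegral Xt] [IsLocallyNoetherian Xt]
    (π : Xt ⟶ Spec (.of O)) (D : CartierDivisor Xt) (η : Xt) : ℤ :=
  ∑ᶠ y : (ClosedSubvariety.ofPoint Xt η).carrier,
    (D.pullbackRep (ClosedSubvariety.ofPoint Xt η).ι).ordAt y *
      ((((ClosedSubvariety.ofPoint Xt η).ι ≫ toSpecField k π).residueDegree y : ℕ) : ℤ)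

/-- **The multiplicity of the exceptional curve `C_η` in the cycle of the maximal ideal**
`𝔪𝒪_{X̃}`: `min { ord_η(g) : g ∈ 𝔪, g ≠ 0 }` (Mathlib `Scheme.ord` at the codimension-one point
`η`, through `𝒪 → K(X̃)`; junk value `0` if `𝔪 = 0`). For a rational surface singularity
`𝔪𝒪_{X̃} = 𝒪_{X̃}(-Z)` with `Z = Σ z_i C_i` the fundamental cycle (the least positive cycle with
`Z · C_i ≤ 0` for all `i`), so this is the multiplicity `z_i` of `C_i = C_η` in `Z`
(Artin 1966, Thm. 4; Bădescu 2001, Def. 3.20 and Thm. 3.28). [cite: Badescu2001, Thm. 3.28] -/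
def maximalIdealCycleMult [IsLocalRing O] [IsIntegral Xt] [IsLocallyNoetherian Xt]
    (π : Xt ⟶ Spec (.of O)) (η : Xt) : ℕ :=
  sInf ((fun g : O => (Scheme.ord (baseToFunctionField π g) η).toNat) ''
    {g : O | g ∈ maximalIdeal O ∧ g ≠ 0})

/-! ## The Chern class of the full sheaf `M̃ = π^*M / torsion`, as a Cartier divisor -/

/-- The `r × r` minors of an additive map `φ : M → K(X̃)^r`: the set of determinants
`det (φ(m_a)_b)_{a,b}` for `m : Fin r → M`. When `φ` is an `𝒪`-linear embedding of a torsion-free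
`M` of rank `r`, their `𝒪_{X̃,x}`-span inside `∧^r K^r = K` is the stalk at `x` of the determinant
`det M̃ = ∧^r M̃` of the full sheaf `M̃ = π^*M/torsion = 𝒪_{X̃} · M ⊆ K^r` (which is locally free,
Artin–Verdier, Lemma (1.1) (ii)). [cite: ArtinVerdier1985, Lemma (1.1) and Remark (1.6)] -/
def fullSheafMinors [IsIntegral Xt] {M : Type u} [AddCommGroup M] {r : ℕ}
    (φ : M →+ (Fin r → Xt.functionField)) : Set Xt.functionField :=
  {a | ∃ m : Fin r → M, (Matrix.of fun a b => φ (m a) b).det = a}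

/-- Unfolding of `fullSheafMinors`. [folklore] -/
theorem mem_fullSheafMinors_iff [IsIntegral Xt] {M : Type u} [AddCommGroup M] {r : ℕ}
    (φ : M →+ (Fin r → Xt.functionField)) (a : Xt.functionField) :
    a ∈ fullSheafMinors φ ↔ ∃ m : Fin r → M, (Matrix.of fun a b => φ (m a) b).det = a :=
  Iff.rfl

/-- **`D` represents the first Chern class `c₁(M̃) = [det M̃] ∈ Pic X̃` of the full sheaf
`M̃ = π^*M/(𝔪-torsion)`** (Artin–Verdier, p. 79 and Remark (1.6) (ii)), concretely: for some
`𝒪`-linear embedding `φ : M ↪ K(X̃)^r`, `r = rank M`, and every chart `U_i` of `D = (U_i, f_i)` and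
`x ∈ U_i`, the stalk `𝒪_{X̃}(D)_x = f_i⁻¹ · 𝒪_{X̃,x} ⊆ K(X̃)` equals the `𝒪_{X̃,x}`-span of the
`r × r` minors of `φ(M)` (the stalk of `det M̃`). Another embedding multiplies all minors by one
element of `K^×`, replacing `D` by a linearly equivalent divisor, so the class of `D` is `c₁(M̃)`.
[cite: ArtinVerdier1985, Remark (1.6) (ii)] -/
def IsChernDivisorOfFullSheaf [IsIntegral Xt] (π : Xt ⟶ Spec (.of O)) (M : Type u) [AddCommGroup M]
    [Module O M] (D : CartierDivisor Xt) : Prop :=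
  ∃ φ : M →+ (Fin (Module.finrank O M) → Xt.functionField),
    (∀ (a : O) (m : M), φ (a • m) = baseToFunctionField π a • φ m) ∧ Function.Injective φ ∧
      ∀ (i : D.ι) (x : Xt), x ∈ D.U i →
        Submodule.span (Xt.presheaf.stalk x) (fullSheafMinors φ) =
          Submodule.span (Xt.presheaf.stalk x) {(D.f i)⁻¹}

end Germ

/-! ## Rational double points with their minimal resolution -/

/-- **The hypotheses of Artin–Verdier's theorem** on `(k, 𝒪, π : X̃ → Spec 𝒪)`: "`𝒪` a complete local
algebra of dimension `2` with maximal ideal `𝔪` over an algebraically closed field `k`, such that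
`𝒪/𝔪 ≃ k`", whose spectrum "is a rational double point [Artin 1966, Lipman 1969]", and
"`X̃ → X` the minimal resolution" (Artin–Verdier, p. 79): `𝒪` is an `𝔪`-adically complete
Noetherian local normal domain of Krull dimension `2` with `k → 𝒪 → 𝒪/𝔪` surjective; `π` is a
minimal resolution; the singularity is RATIONAL — `H¹(X̃, 𝒪_{X̃}) = 0`, i.e. `R¹π_*𝒪_{X̃} = 0` over
the affine base (Bădescu, Def. 3.17), stated as the vanishing of the Čech `Ȟ¹(𝒰, 𝒪_{X̃})`
(`Morphisms/CechH1`) of every finite affine open cover of the separated scheme `X̃` — and a DOUBLE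
POINT — embedding dimension `dim_k 𝔪/𝔪² = 3` (for rational surface singularities the multiplicity
is `edim - 1`, Artin 1966, Cor. 6 = Bădescu, Cor. 3.29). Algebraic closedness of `k` is kept as a
separate hypothesis of the theorem. [cite: ArtinVerdier1985, Introduction (p. 79)] -/
structure IsRationalDoublePointResolution (k : Type u) [Field k] {O : Type u} [CommRing O]
    [IsLocalRing O] [Algebra k O] {Xt : Scheme.{u}} (π : Xt ⟶ Spec (.of O)) : Prop where
  /-- `𝒪` is a Noetherian domain -/
  isDomain : IsDomain O
  isNoetherianRing : IsNoetherianRing O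
  /-- `𝒪` is `𝔪`-adically complete -/
  isAdicComplete : IsAdicComplete (maximalIdeal O) O
  /-- `dim 𝒪 = 2` -/
  ringKrullDim_eq : ringKrullDim O = 2
  /-- `𝒪` is normal -/
  isIntegrallyClosed : IsIntegrallyClosed O
  /-- the residue field is `k`: `k → 𝒪/𝔪` is onto -/
  residue_surjective : ∀ x : O, ∃ c : k, x - algebraMap k O c ∈ maximalIdeal O
  /-- double point: embedding dimension `3` -/
  finrank_cotangentSpace : Module.finrank (ResidueField O) (CotangentSpace O) = 3
  /-- `π` is the minimal resolution -/
  isMinimalResolution : IsMinimalResolution π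
  /-- rational: `H¹(X̃, 𝒪_{X̃}) = 0`, as Čech cohomology of finite affine open covers -/
  subsingleton_cechH1 : ∀ (ι : Type u) [Finite ι] (U : ι → Xt.Opens),
    (∀ i, IsAffineOpen (U i)) → ⨆ i, U i = ⊤ → Subsingleton (CechH1 π U)

/-- The data of `IsRationalDoublePointResolution` include that `π` is a resolution of
singularities. [folklore] -/
theorem IsRationalDoublePointResolution.isResolution {k : Type u} [Field k] {O : Type u}
    [CommRing O] [IsLocalRing O] [Algebra k O] {Xt : Scheme.{u}} {π : Xt ⟶ Spec (.of O)}
    (h : IsRationalDoublePointResolution k π) : IsResolution π :=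
  h.isMinimalResolution.isResolution

/-- In particular `π` is proper. [folklore] -/
theorem IsRationalDoublePointResolution.isProper {k : Type u} [Field k] {O : Type u}
    [CommRing O] [IsLocalRing O] [Algebra k O] {Xt : Scheme.{u}} {π : Xt ⟶ Spec (.of O)}
    (h : IsRationalDoublePointResolution k π) : IsProper π :=
  h.isResolution.isProper

/-! ## The theorem -/

/-- NAMED FACT — **Artin–Verdier 1985, Theorem (1.11) (i)**: over a complete rational double point
`𝒪` with algebraically closed residue field `k` (any characteristic) and minimal resolution
`π : X̃ → Spec 𝒪` with exceptional curves `C_i`, the first Chern class of the full sheaf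
`M̃ = π^*M/torsion` sets up a bijection between isomorphism classes of non-trivial (`≇ 𝒪`)
indecomposable reflexive `𝒪`-modules `M` and the curves `C_i`, with `c₁(M̃_i) · C_j = δ_ij` and
`rank M_i =` the multiplicity of `C_i` in the fundamental cycle. Clauses: (a) for every such `M`
a Chern divisor `D` of `M̃` exists (`M̃` is locally free, Lemma (1.1)), and there is an exceptional
curve `C_η` with `D · C_η = 1` and `D · C_{η'} = 0` for `η' ≠ η`, for every Chern divisor `D` of
`M̃`, and `rank M = mult_{C_η}(𝔪𝒪_{X̃}) (= z_η)`; (b) two such modules whose Chern classes meet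
the same `C_η` with degree `1` are isomorphic; (c) every `C_η` so arises. (Printed form: "`c₁(M̃)`
is represented by a transversal divisor `D̃_i` to a component `C_i` … the multiplicity of `C_i` in
the fundamental cycle `Z` is `(D̃_i · Z) = rank M`. The Chern class establishes a 1–1
correspondence between isomorphism classes of non-trivial, indecomposable reflexive `𝒪`-modules
and irreducible components of `C`"; the numerical form is the one of Wunram 1988, Thm. 1.2 and
Liedtke 2024, Thm. 5.6.) Users take `(h : ArtinVerdier1985_chernClassBijection)`.
[cite: ArtinVerdier1985, Theorem (1.11) (i)] -/
def ArtinVerdier1985_chernClassBijection : Prop :=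
  ∀ (k : Type u) [Field k] [IsAlgClosed k] (O : Type u) [CommRing O] [IsLocalRing O] [Algebra k O]
    (Xt : Scheme.{u}) [IsIntegral Xt] [IsLocallyNoetherian Xt] (π : Xt ⟶ Spec (.of O)),
    IsRationalDoublePointResolution k π →
    -- (a) the Chern class of a non-trivial indecomposable reflexive module is dual to one curve
    (∀ (M : Type u) [AddCommGroup M] [Module O M], Module.Finite O M → Module.IsReflexive O M →
        Indecomposable (ModuleCat.of O M) → IsEmpty (M ≃ₗ[O] O) →
        (∃ D : CartierDivisor Xt, IsChernDivisorOfFullSheaf π M D) ∧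
          ∃ η ∈ excPoints π,
            (∀ D : CartierDivisor Xt, IsChernDivisorOfFullSheaf π M D →
              excDegree k π D η = 1 ∧ ∀ η' ∈ excPoints π, η' ≠ η → excDegree k π D η' = 0) ∧
            Module.finrank O M = maximalIdealCycleMult π η) ∧
    -- (b) injectivity on isomorphism classes
    (∀ (M : Type u) [AddCommGroup M] [Module O M] (M' : Type u) [AddCommGroup M'] [Module O M'],
        Module.Finite O M → Module.IsReflexive O M → Indecomposable (ModuleCat.of O M) →
        IsEmpty (M ≃ₗ[O] O) →
        Module.Finite O M' → Module.IsReflexive O M' → Indecomposable (ModuleCat.of O M') →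
        IsEmpty (M' ≃ₗ[O] O) →
        ∀ (D D' : CartierDivisor Xt), IsChernDivisorOfFullSheaf π M D →
          IsChernDivisorOfFullSheaf π M' D' →
          ∀ η ∈ excPoints π, excDegree k π D η = 1 → excDegree k π D' η = 1 →
            Nonempty (M ≃ₗ[O] M')) ∧
    -- (c) every exceptional curve is the curve of some non-trivial indecomposable reflexive module
    (∀ η ∈ excPoints π, ∃ (M : Type u) (_ : AddCommGroup M) (_ : Module O M),
        Module.Finite O M ∧ Module.IsReflexive O M ∧ Indecomposable (ModuleCat.of O M) ∧
        IsEmpty (M ≃ₗ[O] O) ∧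
        ∃ D : CartierDivisor Xt, IsChernDivisorOfFullSheaf π M D ∧ excDegree k π D η = 1)

end Literature.AlgebraicGeometry.Resolution

end
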